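/-
Copyright (c) 2026 the pub-hodgecm-mathlib formalisation cell (harness21).  Prover seat hodgecm-mathlib-K2E1-p14 (g3), Track B ∕ K2-LIT, h413 = `stmt-HodgeConjecture-24833`,
R90-TF section S8 «ContSpec-n½», socket #2 ∕ (E) road at N = 3 (S8 dealer R90-CS-plan (g3) S8-R128 (1)): the U-BUILDER brick — the canonical THREE-SLOT block model
`U = ((P_T, P_M), U_Λ) ∘ P_{Sc}` of a `(χ₁, χ₂)`-block of `L²(U(J₃)_{L∕L⁺})` from two finite residue families and a continuous-spectrum coordinate, with the read-backs
`hUker ∕ hUinj ∕ hTop ∕ hMid ∕ ha ∕ hm` that ★ p863182 `hL_kType_of_adapted_model` and ★ (N_blk,₃) eat DISCHARGED by Hilbert-space algebra (N = 3 twin of ★ K2E1-p15 `R90S8ResHBlockModelFamilyU2`).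
-/
import Summits.HodgeConjecture.HodgeConjecture.Theorems.R90S8ResGAtomModelSplitU3        -- ★ p863182 (this seat): `hatom_of_adapted`, `resGAtom_eq_resGAtomTop_sup_resGAtomMid_of_adapted`, `resGAtom{,K}_le_lines_sup_midBlocks_of_adapted_model`; brings ★ p863067 (L₃), ★ G-DEFS, ★ F6
import Mathlib.Analysis.InnerProductSpace.Projection.Submodule                           -- Mathlib `Submodule.orthogonalProjectionOnto`, `starProjection`, `inf_orthogonal`, `orthogonalProjectionOnto_eq_zero_iff`
import Mathlib.Analysis.InnerProductSpace.Projection.FiniteDimensional                   -- Mathlib: finite-dimensional subspaces admit the orthogonal projection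
import HarnessLib

/-!
# S8 #2 ∕ (E) road at N = 3 — `R90S8ResGAtomModelFamilyU3`: THE THREE-SLOT BLOCK-MODEL MAP `U = ((P_T, P_M), U_Λ) ∘ P_{Sc}` OF A `(χ₁, χ₂)`-BLOCK, BUILT from two finite residue families
# `eTop`, `eMid` and a continuous-spectrum coordinate `U_Λ`, and its read-backs `hUker ∕ hUfac ∕ hUinj ∕ hTop ∕ hMid ∕ ha ∕ hm` DISCHARGED (the U-builder brick; N = 3 twin of ★ `R90S8ResHBlockModelFamilyU2`)

Track B ∕ K2-LIT, crux h413 = `stmt-HodgeConjecture-24833`, route of record `HCCMUnconditional`; cell `hodgecm-mathlib`, R90-TF programme, section S8 «ContSpec-n½», socket #2's ED. 5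
sub-socket (E) (S8-R68); deal S8-R128 (1) (census `K2/K2E1-p14/g3/CENSUS-ModelFamily3.K2E1-p14-g3.md` 02ce2e8ec2b0957d, design (3) «Gram∕projection canonical model», silence = «=»).
THEOREMS ONLY (no `def`, no `instance`, no `notation`, no named-fact hypothesis, no `sorry`; default heartbeats; the model map is written INLINE and exported through ONE `∃`-package, exactly as
★ `exists_blockModelFamily` at N = 2); lane `--supports stmt-HodgeConjecture-24833 --as helper` (count-neutral).  CLOSES NO SOCKET.

THE MATHEMATICS ([MoeglinWaldspurger1995, V.3.13, VI.2]; [ReedSimonI1980, Thm. II.3]; [Rogawski1990, §13.9 p. 229 (i)–(ii)]).  Let `Sc = resGBlock K′ ω χ₁ χ₂ ≤ L²` (closed, hence complete: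
orthogonal projection `P_{Sc}`).  The E1 estate's spectral data of the block are: the TOP-pole residue classes `eTop : ιt → L²` (finitely many; multiples of one `[ψ∘det]`), the MIDDLE-pole
residue classes `eMid : ιm → L²` (finitely many at a level), and the CONTINUOUS-SPECTRUM COORDINATE `U_Λ : Sc →ₗ Λ` (Plancherel on the unitary axis; E1's `Λ = Lp E 2 m` with Hecke
multipliers).  Put `T := span (range eTop)`, `M := span (range eMid)` (finite-dimensional, so `P_T`, `P_M` exist) and
`U := ((P_T ∘ ι, P_M ∘ ι), U_Λ) ∘ P_{Sc} : L² →ₗ (T × M) × Λ`, coordinates `a k := ⟨eTop k⟩ ∈ T`, `m k := ⟨eMid k⟩ ∈ M`.  From the four PRIMITIVE letters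
(B) `eTop k, eMid k ∈ Sc`; (⊥) `⟪eTop k, eMid k′⟫ = 0` (top ⟂ middle residues: distinct infinitesimal characters); (R) `U_Λ (eTop k) = U_Λ (eMid k) = 0` (residues have no continuous
spectrum); (C) COMPLETENESS `U_Λ v = 0 → v ∈ T ⊔ M` (a block vector without continuous spectrum is a combination of the listed residues — (L₃)'s irreducible analytic core [MW VI.2],
stated ONCE here at the builder), Hilbert-space algebra gives ALL the model-side read-backs: `hUker : Scᗮ ≤ ker U` and `hUfac` (by construction), the read-back on `Sc`, the line
coordinate `(U v).2 = U_Λ v` (so E1's Hecke-multiplier letter `hU` transfers), `hUinj` ((C): `v ∈ T ⊔ M`, and `P_T v = P_M v = 0` puts `v ∈ Tᗮ ⊓ Mᗮ = (T ⊔ M)ᗮ`, so `v = 0`),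
`hTop ∕ hMid` ((⊥) + (R): `U (eTop k) = ((a k, 0), 0)`, `U (eMid k) = ((0, m k), 0)`), `ha ∕ hm` (a family spans its own span).  NO linear independence of the residue classes is needed.
Hence ★ p863182 `hatom_of_adapted` ∕ `resGAtom_eq_resGAtomTop_sup_resGAtomMid_of_adapted` ∕ `resGAtom_le_lines_sup_midBlocks_of_adapted_model` fire for THIS `U` with only
(B)(⊥)(R)(C) + the per-class analytic letters visible (§3).
* §1 GENERIC (any complex inner-product space): `hasOrthogonalProjection_span_range` (instance supply), `span_range_mk_mem_span_eq_top`, `mem_span_range_mk`, `mem_orthogonal_span_mid ∕ _top`;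
  the THREE-SLOT MODEL on any `Sc` with `[Sc.HasOrthogonalProjection]`: `threeSlot_apply_of_mem` (read-back), `threeSlot_orthogonal_le_ker` (`hUker`), `threeSlot_factor` (`hUfac`),
  `threeSlot_snd_apply_of_mem` (line coordinate), **`threeSlot_injOn`** ((C) ⟹ `hUinj`), **`threeSlot_top`**, **`threeSlot_mid`** ((B)(⊥)(R) ⟹ adaptedness).
* §2 AT THE BLOCK OF RECORD `resGBlock L μ K' ω χ₁ χ₂`: `completeSpace_resGBlock` (instance supply) and THE PACKAGE **`exists_threeSlotModel_resGBlock`** (`∃ U`, eight read-backs).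
* §3 CONSEQUENCES for the packaged `U` (★ p863182 ∕ ★ p863067 by name): **`exists_threeSlotModel_resGBlock_split`** (+ `resGAtom = resGAtomTop ⊔ resGAtomMid` and `hatom`),
  **`exists_threeSlotModel_resGBlock_le_lines_sup_midBlocks`** (+ (L₃) `resGAtom ≤ (⨆_ψ ℂ·[ψ∘det]) ⊔ ⨆_ξ resGMidBlock ξ μω` under the per-class letters), and the FAMILY form over any block
  index **`exists_threeSlotModelFamily`** (one `U i b` per block, all read-backs; by `choose`).
HONEST LABEL: HC_CM is proved only modulo the 7 printed citations (2 remaining named inputs: hLiu418 = `stmt-HodgeConjecture-24832`, h413 = `stmt-HodgeConjecture-24833`) until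
rung 0 closes; REL ≠ ★ ≠ BUILT; this file asserts no named fact and closes no socket: its visible letters (B)(⊥)(R)(C) and `U_Λ` itself are the E1 estate's analytic deliverables at N = 3
([MW VI.2] spectral decomposition of the block); count-neutral.

## References
* [MoeglinWaldspurger1995] C. Mœglin, J.-L. Waldspurger, *Spectral Decomposition and Eisenstein Series* (1995), V.3.13, VI.2.
* [ReedSimonI1980] M. Reed, B. Simon, *Methods of Modern Mathematical Physics I: Functional Analysis* (1980), Thm. II.3 (projection theorem).
* [Rogawski1990] J. D. Rogawski, *Automorphic Representations of Unitary Groups in Three Variables* (1990), §13.9 p. 229 (i)–(ii).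
-/

set_option autoImplicit false
set_option linter.dupNamespace false  -- the mandated namespace `…HodgeConjecture.HodgeConjecture.R90.S8` (LEAD #1 L1) repeats the summit's segment

noncomputable section

open MeasureTheory Measure Set Filter Topology NumberField
open Literature.NumberTheory.Automorphic Literature.NumberTheory.Automorphic.UnitaryGroup Literature.NumberTheory.GaloisRepresentations AdelicGroupData
open Literature.NumberTheory.Automorphic.Arthur2013.Leaves.TECR Literature.NumberTheory.Rogawski1990
open Summit.HodgeConjecture.HodgeConjecture.Cruxes.H413.K2E1ChiEisensteinTopResidueCharLineU3 (mem_iSup_lineSubrep_cmDetChar_three_of_ae_eq)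
open ContRepresentation
open scoped ENNReal NNReal InnerProductSpace

namespace Summit.HodgeConjecture.HodgeConjecture.R90.S8

/-! ## §1 Generic: spans of finite families, orthogonality, and the three-slot model `((P_T ∘ ι, P_M ∘ ι), U_Λ) ∘ P_{Sc}` on any `Sc` with an orthogonal projection -/

section Generic

variable {H : Type*} [NormedAddCommGroup H] [InnerProductSpace ℂ H]

/-- Instance supply (used with `haveI` in proofs): the span of a FINITE family in a complex inner-product space admits the orthogonal projection (finite-dimensional ⇒ complete).
[cite: ReedSimonI1980, Thm. II.3] -/
theorem hasOrthogonalProjection_span_range {ι : Type*} [Finite ι] (e : ι → H) : (Submodule.span ℂ (Set.range e)).HasOrthogonalProjection := by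
  haveI : FiniteDimensional ℂ (Submodule.span ℂ (Set.range e)) := FiniteDimensional.span_of_finite ℂ (Set.finite_range e)
  infer_instance

/-- A family, read inside its own span, spans it (`Submodule.span_span_coe_preimage`). [cite: ReedSimonI1980, Thm. II.3] -/
theorem span_range_mk_mem_span_eq_top {ι : Type*} (e : ι → H) :
    Submodule.span ℂ (Set.range fun k : ι => (⟨e k, Submodule.subset_span ⟨k, rfl⟩⟩ : ↥(Submodule.span ℂ (Set.range e)))) = ⊤ := by
  have h := Submodule.span_span_coe_preimage (R := ℂ) (s := Set.range e)
  convert h using 2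
  ext x; constructor
  · rintro ⟨k, rfl⟩; exact ⟨k, rfl⟩
  · rintro ⟨k, hk⟩; exact ⟨k, Subtype.ext hk⟩

/-- The `ha ∕ hm` read-back shape of ★ p863182: every element of the slot `span (range e)` lies in the span of the coordinates `k ↦ ⟨e k⟩`. [cite: ReedSimonI1980, Thm. II.3] -/
theorem mem_span_range_mk {ι : Type*} (e : ι → H) (x : ↥(Submodule.span ℂ (Set.range e))) :
    x ∈ Submodule.span ℂ (Set.range fun k : ι => (⟨e k, Submodule.subset_span ⟨k, rfl⟩⟩ : ↥(Submodule.span ℂ (Set.range e)))) := by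
  rw [span_range_mk_mem_span_eq_top]; trivial

/-- (⊥) ⟹ a top residue class is orthogonal to the middle span. [cite: MoeglinWaldspurger1995, VI.2] -/
theorem mem_orthogonal_span_mid {ιt ιm : Type*} (eTop : ιt → H) (eMid : ιm → H) (horth : ∀ k k', ⟪eTop k, eMid k'⟫_ℂ = 0) (k : ιt) :
    eTop k ∈ (Submodule.span ℂ (Set.range eMid))ᗮ := by
  have hle : Submodule.span ℂ (Set.range eMid) ≤ (ℂ ∙ eTop k)ᗮ :=
    Submodule.span_le.2 (Set.range_subset_iff.2 fun k' => Submodule.mem_orthogonal_singleton_iff_inner_right.2 (horth k k'))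
  exact Submodule.orthogonal_le hle (Submodule.le_orthogonal_orthogonal _ (Submodule.mem_span_singleton_self _))

/-- (⊥) ⟹ a middle residue class is orthogonal to the top span. [cite: MoeglinWaldspurger1995, VI.2] -/
theorem mem_orthogonal_span_top {ιt ιm : Type*} (eTop : ιt → H) (eMid : ιm → H) (horth : ∀ k k', ⟪eTop k, eMid k'⟫_ℂ = 0) (k' : ιm) :
    eMid k' ∈ (Submodule.span ℂ (Set.range eTop))ᗮ := by
  have hle : Submodule.span ℂ (Set.range eTop) ≤ (ℂ ∙ eMid k')ᗮ :=
    Submodule.span_le.2 (Set.range_subset_iff.2 fun k => Submodule.mem_orthogonal_singleton_iff_inner_left.2 (horth k k'))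
  exact Submodule.orthogonal_le hle (Submodule.le_orthogonal_orthogonal _ (Submodule.mem_span_singleton_self _))

end Generic

section ThreeSlot

variable {H : Type*} [NormedAddCommGroup H] [InnerProductSpace ℂ H] {Λ : Type*} [AddCommGroup Λ] [Module ℂ Λ]
  (Sc : Submodule ℂ H) [Sc.HasOrthogonalProjection] {ιt ιm : Type*} (eTop : ιt → H) (eMid : ιm → H)
  [(Submodule.span ℂ (Set.range eTop)).HasOrthogonalProjection] [(Submodule.span ℂ (Set.range eMid)).HasOrthogonalProjection]
  (UΛ : ↥Sc →ₗ[ℂ] Λ)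

/-- **READ-BACK ON THE BLOCK**: for `v ∈ Sc`, `U v = ((P_T v, P_M v), U_Λ v)` (`P_{Sc} v = v`). [cite: ReedSimonI1980, Thm. II.3] -/
theorem threeSlot_apply_of_mem {v : H} (hv : v ∈ Sc) :
    (((((Submodule.span ℂ (Set.range eTop)).orthogonalProjectionOnto.toLinearMap ∘ₗ Sc.subtype).prod
        ((Submodule.span ℂ (Set.range eMid)).orthogonalProjectionOnto.toLinearMap ∘ₗ Sc.subtype)).prod UΛ) ∘ₗ Sc.orthogonalProjectionOnto.toLinearMap) v =
      (((Submodule.span ℂ (Set.range eTop)).orthogonalProjectionOnto v, (Submodule.span ℂ (Set.range eMid)).orthogonalProjectionOnto v), UΛ ⟨v, hv⟩) := by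
  have hP : Sc.orthogonalProjectionOnto v = ⟨v, hv⟩ := Submodule.orthogonalProjectionOnto_mem_subspace_eq_self (⟨v, hv⟩ : ↥Sc)
  rw [LinearMap.comp_apply, ContinuousLinearMap.coe_coe, hP]
  rfl

/-- **LINE-COORDINATE READ-BACK**: for `v ∈ Sc`, `(U v).2 = U_Λ v` — so a letter about `U_Λ` (E1's Hecke multipliers `hU`) is a letter about `snd ∘ U`. [cite: MoeglinWaldspurger1995, VI.2] -/
theorem threeSlot_snd_apply_of_mem {v : H} (hv : v ∈ Sc) :
    ((((((Submodule.span ℂ (Set.range eTop)).orthogonalProjectionOnto.toLinearMap ∘ₗ Sc.subtype).prod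
        ((Submodule.span ℂ (Set.range eMid)).orthogonalProjectionOnto.toLinearMap ∘ₗ Sc.subtype)).prod UΛ) ∘ₗ Sc.orthogonalProjectionOnto.toLinearMap) v).2 = UΛ ⟨v, hv⟩ := by
  rw [threeSlot_apply_of_mem Sc eTop eMid UΛ hv]

/-- **`hUker`: `Scᗮ ≤ ker U`** (the (N_blk,₃) consumer's factorisation letter) — `P_{Sc}` kills `Scᗮ`. [cite: ReedSimonI1980, Thm. II.3] -/
theorem threeSlot_orthogonal_le_ker :
    Scᗮ ≤ LinearMap.ker (((((Submodule.span ℂ (Set.range eTop)).orthogonalProjectionOnto.toLinearMap ∘ₗ Sc.subtype).prod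
        ((Submodule.span ℂ (Set.range eMid)).orthogonalProjectionOnto.toLinearMap ∘ₗ Sc.subtype)).prod UΛ) ∘ₗ Sc.orthogonalProjectionOnto.toLinearMap) := by
  intro y hy
  rw [LinearMap.mem_ker, LinearMap.comp_apply, ContinuousLinearMap.coe_coe, Submodule.orthogonalProjectionOnto_apply_of_mem_orthogonal hy, map_zero]

/-- **`hUfac`: FACTORISATION THROUGH THE BLOCK** — `U y = U (P_{Sc} y)` with `P_{Sc} y ∈ Sc`, `y − P_{Sc} y ⟂ Sc`. [cite: ReedSimonI1980, Thm. II.3] -/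
theorem threeSlot_factor (y : H) :
    ∃ y' ∈ Sc, y - y' ∈ Scᗮ ∧
      (((((Submodule.span ℂ (Set.range eTop)).orthogonalProjectionOnto.toLinearMap ∘ₗ Sc.subtype).prod
        ((Submodule.span ℂ (Set.range eMid)).orthogonalProjectionOnto.toLinearMap ∘ₗ Sc.subtype)).prod UΛ) ∘ₗ Sc.orthogonalProjectionOnto.toLinearMap) y =
      (((((Submodule.span ℂ (Set.range eTop)).orthogonalProjectionOnto.toLinearMap ∘ₗ Sc.subtype).prod
        ((Submodule.span ℂ (Set.range eMid)).orthogonalProjectionOnto.toLinearMap ∘ₗ Sc.subtype)).prod UΛ) ∘ₗ Sc.orthogonalProjectionOnto.toLinearMap) y' := by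
  refine ⟨Sc.starProjection y, Submodule.starProjection_apply_mem _ y, Submodule.sub_starProjection_mem_orthogonal y, ?_⟩
  have h0 := threeSlot_orthogonal_le_ker Sc eTop eMid UΛ (Submodule.sub_starProjection_mem_orthogonal (K := Sc) y)
  rw [LinearMap.mem_ker, map_sub, sub_eq_zero] at h0
  exact h0

/-- **`hUinj` FROM COMPLETENESS (C)**: if `U_Λ v = 0 ⟹ v ∈ T ⊔ M` on `Sc`, then `U` is injective on `Sc` — `P_T v = P_M v = 0` puts `v ∈ Tᗮ ⊓ Mᗮ = (T ⊔ M)ᗮ` (`Submodule.inf_orthogonal`),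
so `v ∈ (T ⊔ M) ⊓ (T ⊔ M)ᗮ = ⊥`.  No linear independence of the residue classes is used. [cite: MoeglinWaldspurger1995, VI.2] [cite: ReedSimonI1980, Thm. II.3] -/
theorem threeSlot_injOn (hC : ∀ v : ↥Sc, UΛ v = 0 → (v : H) ∈ Submodule.span ℂ (Set.range eTop) ⊔ Submodule.span ℂ (Set.range eMid)) :
    ∀ v ∈ Sc, (((((Submodule.span ℂ (Set.range eTop)).orthogonalProjectionOnto.toLinearMap ∘ₗ Sc.subtype).prod
        ((Submodule.span ℂ (Set.range eMid)).orthogonalProjectionOnto.toLinearMap ∘ₗ Sc.subtype)).prod UΛ) ∘ₗ Sc.orthogonalProjectionOnto.toLinearMap) v = 0 → v = 0 := by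
  intro v hv h0
  rw [threeSlot_apply_of_mem Sc eTop eMid UΛ hv, Prod.mk_eq_zero, Prod.mk_eq_zero] at h0
  obtain ⟨⟨hT, hM⟩, hΛ⟩ := h0
  have hvT : v ∈ (Submodule.span ℂ (Set.range eTop))ᗮ := Submodule.orthogonalProjectionOnto_eq_zero_iff.1 hT
  have hvM : v ∈ (Submodule.span ℂ (Set.range eMid))ᗮ := Submodule.orthogonalProjectionOnto_eq_zero_iff.1 hM
  have hvR : v ∈ Submodule.span ℂ (Set.range eTop) ⊔ Submodule.span ℂ (Set.range eMid) := hC ⟨v, hv⟩ hΛ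
  have hvR' : v ∈ (Submodule.span ℂ (Set.range eTop) ⊔ Submodule.span ℂ (Set.range eMid))ᗮ := by
    rw [← Submodule.inf_orthogonal]; exact ⟨hvT, hvM⟩
  have : v ∈ (Submodule.span ℂ (Set.range eTop) ⊔ Submodule.span ℂ (Set.range eMid)) ⊓ (Submodule.span ℂ (Set.range eTop) ⊔ Submodule.span ℂ (Set.range eMid))ᗮ := ⟨hvR, hvR'⟩
  rwa [Submodule.inf_orthogonal_eq_bot, Submodule.mem_bot] at this

/-- **`hTop` — ADAPTEDNESS OF THE TOP FAMILY** from (B), (⊥), (R): `U (eTop k) = ((⟨eTop k⟩, 0), 0)` (`P_T (eTop k) = ⟨eTop k⟩`, `P_M (eTop k) = 0` as `eTop k ⟂ M`, `U_Λ (eTop k) = 0`).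
[cite: MoeglinWaldspurger1995, V.3.13, VI.2] [cite: Rogawski1990, §13.9 p. 229 (i)] -/
theorem threeSlot_top (hTopSc : ∀ k, eTop k ∈ Sc) (horth : ∀ k k', ⟪eTop k, eMid k'⟫_ℂ = 0) (hRt : ∀ k, UΛ ⟨eTop k, hTopSc k⟩ = 0) (k : ιt) :
    eTop k ∈ Sc ∧ (((((Submodule.span ℂ (Set.range eTop)).orthogonalProjectionOnto.toLinearMap ∘ₗ Sc.subtype).prod
        ((Submodule.span ℂ (Set.range eMid)).orthogonalProjectionOnto.toLinearMap ∘ₗ Sc.subtype)).prod UΛ) ∘ₗ Sc.orthogonalProjectionOnto.toLinearMap) (eTop k) =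
      (((⟨eTop k, Submodule.subset_span ⟨k, rfl⟩⟩ : ↥(Submodule.span ℂ (Set.range eTop))), 0), 0) := by
  refine ⟨hTopSc k, ?_⟩
  rw [threeSlot_apply_of_mem Sc eTop eMid UΛ (hTopSc k), hRt k,
    Submodule.orthogonalProjectionOnto_apply_of_mem_orthogonal (mem_orthogonal_span_mid eTop eMid horth k),
    show (Submodule.span ℂ (Set.range eTop)).orthogonalProjectionOnto (eTop k) = ⟨eTop k, Submodule.subset_span ⟨k, rfl⟩⟩ from
      Submodule.orthogonalProjectionOnto_mem_subspace_eq_self (⟨eTop k, Submodule.subset_span ⟨k, rfl⟩⟩ : ↥(Submodule.span ℂ (Set.range eTop)))]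

/-- **`hMid` — ADAPTEDNESS OF THE MIDDLE FAMILY** from (B), (⊥), (R): `U (eMid k) = ((0, ⟨eMid k⟩), 0)`. [cite: MoeglinWaldspurger1995, V.3.13, VI.2] [cite: Rogawski1990, §13.9 p. 229 (ii)] -/
theorem threeSlot_mid (hMidSc : ∀ k, eMid k ∈ Sc) (horth : ∀ k k', ⟪eTop k, eMid k'⟫_ℂ = 0) (hRm : ∀ k, UΛ ⟨eMid k, hMidSc k⟩ = 0) (k : ιm) :
    eMid k ∈ Sc ∧ (((((Submodule.span ℂ (Set.range eTop)).orthogonalProjectionOnto.toLinearMap ∘ₗ Sc.subtype).prod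
        ((Submodule.span ℂ (Set.range eMid)).orthogonalProjectionOnto.toLinearMap ∘ₗ Sc.subtype)).prod UΛ) ∘ₗ Sc.orthogonalProjectionOnto.toLinearMap) (eMid k) =
      ((0, (⟨eMid k, Submodule.subset_span ⟨k, rfl⟩⟩ : ↥(Submodule.span ℂ (Set.range eMid)))), 0) := by
  refine ⟨hMidSc k, ?_⟩
  rw [threeSlot_apply_of_mem Sc eTop eMid UΛ (hMidSc k), hRm k,
    Submodule.orthogonalProjectionOnto_apply_of_mem_orthogonal (mem_orthogonal_span_top eTop eMid horth k),
    show (Submodule.span ℂ (Set.range eMid)).orthogonalProjectionOnto (eMid k) = ⟨eMid k, Submodule.subset_span ⟨k, rfl⟩⟩ from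
      Submodule.orthogonalProjectionOnto_mem_subspace_eq_self (⟨eMid k, Submodule.subset_span ⟨k, rfl⟩⟩ : ↥(Submodule.span ℂ (Set.range eMid)))]

end ThreeSlot

/-! ## §2 The package at the block of record `Sc := resGBlock L μ K' ω χ₁ χ₂` -/

section Block

variable (L : Type) [Field L] [NumberField L] [IsCMField L]
  (μ : Measure (quasiSplit (↥(maximalRealSubfield L)) L (IsCMField.complexConj L) 3).automorphicQuotient)
  (K' : Subgroup (quasiSplit (↥(maximalRealSubfield L)) L (IsCMField.complexConj L) 3).Adelic) (ω : ↥K' →* ℂ) (χ₁ : HeckeCharacter L) (χ₂ : ↥(TorusDict.torus (IsCMField.complexConj L)) →ₜ* ℂˣ)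

/-- Instance supply (used with `haveI` in proofs): the block is closed in the Hilbert space `L²`, hence complete, so `P_{Sc}` exists (★ `isClosed_resGBlock`). [cite: ReedSimonI1980, Thm. II.3] -/
theorem completeSpace_resGBlock : CompleteSpace ↥(resGBlock L μ K' ω χ₁ χ₂) :=
  (isClosed_resGBlock L μ K' ω χ₁ χ₂).completeSpace_coe

/-- **THE THREE-SLOT BLOCK MODEL OF RECORD — THE PACKAGE.**  From two FINITE residue families `eTop`, `eMid` and a linear continuous-spectrum coordinate `U_Λ` on the block
`Sc = resGBlock L μ K' ω χ₁ χ₂` with the primitive letters (B) `eTop k, eMid k ∈ Sc`, (⊥) `⟪eTop k, eMid k′⟫ = 0`, (R) `U_Λ (eTop k) = U_Λ (eMid k) = 0`, (C) COMPLETENESS `U_Λ v = 0 → v ∈ T ⊔ M` — (C) IS (L₃)'s IRREDUCIBLE CORE = THE (E)-ROAD LETTER [MW VI.2] (not bookkeeping: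
it says the block vectors without continuous spectrum are the listed residues) — there is a
block-model map `U : L² →ₗ[ℂ] (T × M) × Λ` (namely `((P_T ∘ ι, P_M ∘ ι), U_Λ) ∘ P_{Sc}`, `T = span (range eTop)`, `M = span (range eMid)`) with ALL the model-side read-backs the (E)-road
letters eat: `hUker` ((N_blk,₃)), `hUfac`, the line coordinate `(U v).2 = U_Λ v` on `Sc` (E1's Hecke-multiplier letter transfers), `hUinj`, `hTop`, `hMid`, `ha`, `hm` (★ p863182).
[cite: MoeglinWaldspurger1995, V.3.13, VI.2] [cite: ReedSimonI1980, Thm. II.3] [cite: Rogawski1990, §13.9 p. 229] -/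
theorem exists_threeSlotModel_resGBlock {Λ : Type*} [AddCommGroup Λ] [Module ℂ Λ] {ιt ιm : Type*} [Finite ιt] [Finite ιm]
    (eTop : ιt → (quasiSplit (↥(maximalRealSubfield L)) L (IsCMField.complexConj L) 3).L2 μ) (eMid : ιm → (quasiSplit (↥(maximalRealSubfield L)) L (IsCMField.complexConj L) 3).L2 μ) (UΛ : ↥(resGBlock L μ K' ω χ₁ χ₂) →ₗ[ℂ] Λ)
    (hTopSc : ∀ k, eTop k ∈ resGBlock L μ K' ω χ₁ χ₂) (hMidSc : ∀ k, eMid k ∈ resGBlock L μ K' ω χ₁ χ₂) (horth : ∀ k k', ⟪eTop k, eMid k'⟫_ℂ = 0)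
    (hRt : ∀ k, UΛ ⟨eTop k, hTopSc k⟩ = 0) (hRm : ∀ k, UΛ ⟨eMid k, hMidSc k⟩ = 0)
    (hC : ∀ v : ↥(resGBlock L μ K' ω χ₁ χ₂), UΛ v = 0 → (v : (quasiSplit (↥(maximalRealSubfield L)) L (IsCMField.complexConj L) 3).L2 μ) ∈ Submodule.span ℂ (Set.range eTop) ⊔ Submodule.span ℂ (Set.range eMid)) :
    ∃ U : (quasiSplit (↥(maximalRealSubfield L)) L (IsCMField.complexConj L) 3).L2 μ →ₗ[ℂ] (↥(Submodule.span ℂ (Set.range eTop)) × ↥(Submodule.span ℂ (Set.range eMid))) × Λ,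
      (resGBlock L μ K' ω χ₁ χ₂)ᗮ ≤ LinearMap.ker U ∧
      (∀ y, ∃ y' ∈ resGBlock L μ K' ω χ₁ χ₂, y - y' ∈ (resGBlock L μ K' ω χ₁ χ₂)ᗮ ∧ U y = U y') ∧
      (∀ (v : (quasiSplit (↥(maximalRealSubfield L)) L (IsCMField.complexConj L) 3).L2 μ) (hv : v ∈ resGBlock L μ K' ω χ₁ χ₂), (U v).2 = UΛ ⟨v, hv⟩) ∧
      (∀ v ∈ resGBlock L μ K' ω χ₁ χ₂, U v = 0 → v = 0) ∧
      (∀ k, eTop k ∈ resGBlock L μ K' ω χ₁ χ₂ ∧ U (eTop k) = (((⟨eTop k, Submodule.subset_span ⟨k, rfl⟩⟩ : ↥(Submodule.span ℂ (Set.range eTop))), 0), 0)) ∧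
      (∀ k, eMid k ∈ resGBlock L μ K' ω χ₁ χ₂ ∧ U (eMid k) = ((0, (⟨eMid k, Submodule.subset_span ⟨k, rfl⟩⟩ : ↥(Submodule.span ℂ (Set.range eMid)))), 0)) ∧
      (∀ x : ↥(Submodule.span ℂ (Set.range eTop)), x ∈ Submodule.span ℂ (Set.range fun k : ιt => (⟨eTop k, Submodule.subset_span ⟨k, rfl⟩⟩ : ↥(Submodule.span ℂ (Set.range eTop))))) ∧
      (∀ y : ↥(Submodule.span ℂ (Set.range eMid)), y ∈ Submodule.span ℂ (Set.range fun k : ιm => (⟨eMid k, Submodule.subset_span ⟨k, rfl⟩⟩ : ↥(Submodule.span ℂ (Set.range eMid))))) := by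
  haveI : CompleteSpace ↥(resGBlock L μ K' ω χ₁ χ₂) := completeSpace_resGBlock L μ K' ω χ₁ χ₂
  haveI := hasOrthogonalProjection_span_range eTop
  haveI := hasOrthogonalProjection_span_range eMid
  exact ⟨((((Submodule.span ℂ (Set.range eTop)).orthogonalProjectionOnto.toLinearMap ∘ₗ (resGBlock L μ K' ω χ₁ χ₂).subtype).prod
      ((Submodule.span ℂ (Set.range eMid)).orthogonalProjectionOnto.toLinearMap ∘ₗ (resGBlock L μ K' ω χ₁ χ₂).subtype)).prod UΛ) ∘ₗ
      (resGBlock L μ K' ω χ₁ χ₂).orthogonalProjectionOnto.toLinearMap,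
    threeSlot_orthogonal_le_ker _ eTop eMid UΛ, threeSlot_factor _ eTop eMid UΛ, fun v hv => threeSlot_snd_apply_of_mem _ eTop eMid UΛ hv,
    threeSlot_injOn _ eTop eMid UΛ hC, threeSlot_top _ eTop eMid UΛ hTopSc horth hRt, threeSlot_mid _ eTop eMid UΛ hMidSc horth hRm,
    mem_span_range_mk eTop, mem_span_range_mk eMid⟩

/-! ## §3 Consequences for the packaged `U`: the split, `hatom`, and (L₃) — by name from ★ p863182 ∕ ★ p863067 -/

/-- **THE PACKAGE WITH THE SPLIT AND `hatom`**: the model of `exists_threeSlotModel_resGBlock` also satisfies `resGAtom L μ U K' ω χ₁ χ₂ = resGAtomTop … ⊔ resGAtomMid …`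
(★ `resGAtom_eq_resGAtomTop_sup_resGAtomMid_of_adapted`) and ★ p863067's model letter `hatom` (★ `hatom_of_adapted`) — visible: (B)(⊥)(R)(C) only.
[cite: MoeglinWaldspurger1995, V.3.13, VI.2] [cite: Rogawski1990, §13.9 p. 229 (i)–(ii)] -/
theorem exists_threeSlotModel_resGBlock_split {Λ : Type*} [AddCommGroup Λ] [Module ℂ Λ] {ιt ιm : Type*} [Finite ιt] [Finite ιm]
    (eTop : ιt → (quasiSplit (↥(maximalRealSubfield L)) L (IsCMField.complexConj L) 3).L2 μ) (eMid : ιm → (quasiSplit (↥(maximalRealSubfield L)) L (IsCMField.complexConj L) 3).L2 μ) (UΛ : ↥(resGBlock L μ K' ω χ₁ χ₂) →ₗ[ℂ] Λ)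
    (hTopSc : ∀ k, eTop k ∈ resGBlock L μ K' ω χ₁ χ₂) (hMidSc : ∀ k, eMid k ∈ resGBlock L μ K' ω χ₁ χ₂) (horth : ∀ k k', ⟪eTop k, eMid k'⟫_ℂ = 0)
    (hRt : ∀ k, UΛ ⟨eTop k, hTopSc k⟩ = 0) (hRm : ∀ k, UΛ ⟨eMid k, hMidSc k⟩ = 0)
    (hC : ∀ v : ↥(resGBlock L μ K' ω χ₁ χ₂), UΛ v = 0 → (v : (quasiSplit (↥(maximalRealSubfield L)) L (IsCMField.complexConj L) 3).L2 μ) ∈ Submodule.span ℂ (Set.range eTop) ⊔ Submodule.span ℂ (Set.range eMid)) :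
    ∃ U : (quasiSplit (↥(maximalRealSubfield L)) L (IsCMField.complexConj L) 3).L2 μ →ₗ[ℂ] (↥(Submodule.span ℂ (Set.range eTop)) × ↥(Submodule.span ℂ (Set.range eMid))) × Λ,
      (resGBlock L μ K' ω χ₁ χ₂)ᗮ ≤ LinearMap.ker U ∧
      (∀ (v : (quasiSplit (↥(maximalRealSubfield L)) L (IsCMField.complexConj L) 3).L2 μ) (hv : v ∈ resGBlock L μ K' ω χ₁ χ₂), (U v).2 = UΛ ⟨v, hv⟩) ∧
      (∀ v ∈ resGBlock L μ K' ω χ₁ χ₂, U v = 0 → v = 0) ∧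
      resGAtom L μ U K' ω χ₁ χ₂ = resGAtomTop L μ U K' ω χ₁ χ₂ ⊔ resGAtomMid L μ U K' ω χ₁ χ₂ ∧
      (∀ v ∈ resGBlock L μ K' ω χ₁ χ₂, (U v).2 = 0 → v ∈ Submodule.span ℂ (Set.range eTop) ⊔ Submodule.span ℂ (Set.range eMid)) := by
  obtain ⟨U, hUker, -, hsnd, hUinj, hTop, hMid, ha, hm⟩ := exists_threeSlotModel_resGBlock L μ K' ω χ₁ χ₂ eTop eMid UΛ hTopSc hMidSc horth hRt hRm hC
  exact ⟨U, hUker, hsnd, hUinj, resGAtom_eq_resGAtomTop_sup_resGAtomMid_of_adapted L μ U K' ω χ₁ χ₂ eTop _ hTop ha,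
    hatom_of_adapted L μ U K' ω χ₁ χ₂ eTop eMid _ _ hUinj hTop hMid ha hm⟩

/-- **THE PACKAGE WITH (L₃)**: under the per-class analytic letters — top classes a.e. `r·Θ((out x)⁻¹)` (★ F6's currency) and middle classes in SOME middle atom `resGMidAtom L μ ξ μω K″ ω″` —
the packaged model satisfies ★ p863067's (L₃) `resGAtom L μ U K' ω χ₁ χ₂ ≤ (⨆_ψ ℂ·[ψ∘det]) ⊔ ⨆_ξ (resGMidBlock L μ ξ μω)` with `hatom` DISCHARGED (★ `resGAtom_le_lines_sup_midBlocks_of_ae_eq`).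
[cite: Rogawski1990, §13.9 p. 229 (i)–(ii), §13.3 p. 202] [cite: MoeglinWaldspurger1995, IV.1.11, V.3.13, VI.2] -/
theorem exists_threeSlotModel_resGBlock_le_lines_sup_midBlocks [(quasiSplit (↥(maximalRealSubfield L)) L (IsCMField.complexConj L) 3).IsAutomorphicMeasure μ] (μω : HeckeCharacter L)
    {Λ : Type*} [AddCommGroup Λ] [Module ℂ Λ] {ιt ιm : Type*} [Finite ιt] [Finite ιm]
    (eTop : ιt → (quasiSplit (↥(maximalRealSubfield L)) L (IsCMField.complexConj L) 3).L2 μ) (eMid : ιm → (quasiSplit (↥(maximalRealSubfield L)) L (IsCMField.complexConj L) 3).L2 μ) (UΛ : ↥(resGBlock L μ K' ω χ₁ χ₂) →ₗ[ℂ] Λ)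
    (hTopSc : ∀ k, eTop k ∈ resGBlock L μ K' ω χ₁ χ₂) (hMidSc : ∀ k, eMid k ∈ resGBlock L μ K' ω χ₁ χ₂) (horth : ∀ k k', ⟪eTop k, eMid k'⟫_ℂ = 0)
    (hRt : ∀ k, UΛ ⟨eTop k, hTopSc k⟩ = 0) (hRm : ∀ k, UΛ ⟨eMid k, hMidSc k⟩ = 0)
    (hC : ∀ v : ↥(resGBlock L μ K' ω χ₁ χ₂), UΛ v = 0 → (v : (quasiSplit (↥(maximalRealSubfield L)) L (IsCMField.complexConj L) 3).L2 μ) ∈ Submodule.span ℂ (Set.range eTop) ⊔ Submodule.span ℂ (Set.range eMid))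
    (heTop : ∀ k, ∃ (Θ : (quasiSplit (↥(maximalRealSubfield L)) L (IsCMField.complexConj L) 3).AutomorphicCharacter) (r : ℂ), ((eTop k : (quasiSplit (↥(maximalRealSubfield L)) L (IsCMField.complexConj L) 3).L2 μ) : (quasiSplit (↥(maximalRealSubfield L)) L (IsCMField.complexConj L) 3).automorphicQuotient → ℂ) =ᵐ[μ]
        fun x => r * ((Θ (Quotient.out (x : (quasiSplit (↥(maximalRealSubfield L)) L (IsCMField.complexConj L) 3).Adelic ⧸ (quasiSplit (↥(maximalRealSubfield L)) L (IsCMField.complexConj L) 3).quotientSubgroup))⁻¹ : ℂˣ) : ℂ))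
    (heMid : ∀ k, ∃ (ξ : OneDimAutRepH L) (K'' : Subgroup (quasiSplit (↥(maximalRealSubfield L)) L (IsCMField.complexConj L) 3).Adelic) (ω'' : ↥K'' →* ℂ), eMid k ∈ resGMidAtom L μ ξ μω K'' ω'') :
    ∃ U : (quasiSplit (↥(maximalRealSubfield L)) L (IsCMField.complexConj L) 3).L2 μ →ₗ[ℂ] (↥(Submodule.span ℂ (Set.range eTop)) × ↥(Submodule.span ℂ (Set.range eMid))) × Λ,
      (resGBlock L μ K' ω χ₁ χ₂)ᗮ ≤ LinearMap.ker U ∧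
      (∀ (v : (quasiSplit (↥(maximalRealSubfield L)) L (IsCMField.complexConj L) 3).L2 μ) (hv : v ∈ resGBlock L μ K' ω χ₁ χ₂), (U v).2 = UΛ ⟨v, hv⟩) ∧
      (∀ v ∈ resGBlock L μ K' ω χ₁ χ₂, U v = 0 → v = 0) ∧
      resGAtom L μ U K' ω χ₁ χ₂ ≤ (⨆ ψ : {ψ : ↥(TorusDict.torus (IsCMField.complexConj L)) →ₜ* ℂˣ // TorusDict.IsAutomorphic (IsCMField.complexConj L) ψ},
        (AdelicGroupData.AutomorphicCharacter.lineSubrep (𝒢 := (quasiSplit (↥(maximalRealSubfield L)) L (IsCMField.complexConj L) 3))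
          (cmDetChar L 3 ((StdForm.antidiagonal 3).over L) ψ.1 ψ.2 ((Matrix.isUnit_iff_isUnit_det _).mp (StdForm.isUnit_over (StdForm.antidiagonal 3) L)).ne_zero) μ).toSubmodule) ⊔ ⨆ ξ : OneDimAutRepH L, (resGMidBlock L μ ξ μω).toSubmodule := by
  obtain ⟨U, hUker, hsnd, hUinj, -, hatom⟩ := exists_threeSlotModel_resGBlock_split L μ K' ω χ₁ χ₂ eTop eMid UΛ hTopSc hMidSc horth hRt hRm hC
  exact ⟨U, hUker, hsnd, hUinj, resGAtom_le_lines_sup_midBlocks_of_mem L μ U K' ω χ₁ χ₂ μω eTop eMid hatom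
    (fun k => by obtain ⟨Θ, r, h⟩ := heTop k; exact mem_iSup_lineSubrep_cmDetChar_three_of_ae_eq L μ Θ r h) heMid⟩

end Block

/-! ## §4 The family form over any block index `(i, b)` — one model per block, all read-backs (for ★ F1_qs's binders at the index of record) -/

section Family

variable (L : Type) [Field L] [NumberField L] [IsCMField L]
  (μ : Measure (quasiSplit (↥(maximalRealSubfield L)) L (IsCMField.complexConj L) 3).automorphicQuotient)

/-- **THE THREE-SLOT MODEL FAMILY**: per block `(i, b)` with level datum `(K′ i b, ω i b)`, Borel datum `(χ₁ i b, χ₂ i b)`, finite residue families `eTop i b`, `eMid i b`, a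
continuous-spectrum coordinate `U_Λ i b` and the letters (B)(⊥)(R)(C), a FAMILY `U i b : L² →ₗ (T i b × M i b) × Λ i b` with all read-backs of `exists_threeSlotModel_resGBlock` — the
shape ★ F1_qs's letter payers (`hEblk`, `hO`, `hN`, `hL`) are fed from (index of record: `K′ i b := (Kf i).map ι_f`, `ω := 1`). [cite: MoeglinWaldspurger1995, V.3.13, VI.2] [cite: ReedSimonI1980, Thm. II.3] -/
theorem exists_threeSlotModelFamily {ι : Type*} {β : ι → Type*}
    (K' : ∀ i, β i → Subgroup (quasiSplit (↥(maximalRealSubfield L)) L (IsCMField.complexConj L) 3).Adelic) (ω : ∀ (i : ι) (b : β i), ↥(K' i b) →* ℂ)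
    (χ₁ : ∀ i, β i → HeckeCharacter L) (χ₂ : ∀ i, β i → (↥(TorusDict.torus (IsCMField.complexConj L)) →ₜ* ℂˣ))
    {Λ : ∀ i, β i → Type*} [∀ i b, AddCommGroup (Λ i b)] [∀ i b, Module ℂ (Λ i b)]
    {ιt ιm : ∀ i, β i → Type*} [∀ i b, Finite (ιt i b)] [∀ i b, Finite (ιm i b)]
    (eTop : ∀ (i : ι) (b : β i), ιt i b → (quasiSplit (↥(maximalRealSubfield L)) L (IsCMField.complexConj L) 3).L2 μ) (eMid : ∀ (i : ι) (b : β i), ιm i b → (quasiSplit (↥(maximalRealSubfield L)) L (IsCMField.complexConj L) 3).L2 μ)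
    (UΛ : ∀ (i : ι) (b : β i), ↥(resGBlock L μ (K' i b) (ω i b) (χ₁ i b) (χ₂ i b)) →ₗ[ℂ] Λ i b)
    (hTopSc : ∀ i b k, eTop i b k ∈ resGBlock L μ (K' i b) (ω i b) (χ₁ i b) (χ₂ i b)) (hMidSc : ∀ i b k, eMid i b k ∈ resGBlock L μ (K' i b) (ω i b) (χ₁ i b) (χ₂ i b))
    (horth : ∀ i b k k', ⟪eTop i b k, eMid i b k'⟫_ℂ = 0)
    (hRt : ∀ i b k, UΛ i b ⟨eTop i b k, hTopSc i b k⟩ = 0) (hRm : ∀ i b k, UΛ i b ⟨eMid i b k, hMidSc i b k⟩ = 0)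
    (hC : ∀ i b, ∀ v : ↥(resGBlock L μ (K' i b) (ω i b) (χ₁ i b) (χ₂ i b)), UΛ i b v = 0 →
      (v : (quasiSplit (↥(maximalRealSubfield L)) L (IsCMField.complexConj L) 3).L2 μ) ∈ Submodule.span ℂ (Set.range (eTop i b)) ⊔ Submodule.span ℂ (Set.range (eMid i b))) :
    ∃ U : ∀ (i : ι) (b : β i), (quasiSplit (↥(maximalRealSubfield L)) L (IsCMField.complexConj L) 3).L2 μ →ₗ[ℂ] (↥(Submodule.span ℂ (Set.range (eTop i b))) × ↥(Submodule.span ℂ (Set.range (eMid i b)))) × Λ i b,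
      ∀ (i : ι) (b : β i),
        (resGBlock L μ (K' i b) (ω i b) (χ₁ i b) (χ₂ i b))ᗮ ≤ LinearMap.ker (U i b) ∧
        (∀ y, ∃ y' ∈ resGBlock L μ (K' i b) (ω i b) (χ₁ i b) (χ₂ i b), y - y' ∈ (resGBlock L μ (K' i b) (ω i b) (χ₁ i b) (χ₂ i b))ᗮ ∧ U i b y = U i b y') ∧
        (∀ (v : (quasiSplit (↥(maximalRealSubfield L)) L (IsCMField.complexConj L) 3).L2 μ) (hv : v ∈ resGBlock L μ (K' i b) (ω i b) (χ₁ i b) (χ₂ i b)), (U i b v).2 = UΛ i b ⟨v, hv⟩) ∧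
        (∀ v ∈ resGBlock L μ (K' i b) (ω i b) (χ₁ i b) (χ₂ i b), U i b v = 0 → v = 0) ∧
        (∀ k, eTop i b k ∈ resGBlock L μ (K' i b) (ω i b) (χ₁ i b) (χ₂ i b) ∧
          U i b (eTop i b k) = (((⟨eTop i b k, Submodule.subset_span ⟨k, rfl⟩⟩ : ↥(Submodule.span ℂ (Set.range (eTop i b)))), 0), 0)) ∧
        (∀ k, eMid i b k ∈ resGBlock L μ (K' i b) (ω i b) (χ₁ i b) (χ₂ i b) ∧
          U i b (eMid i b k) = ((0, (⟨eMid i b k, Submodule.subset_span ⟨k, rfl⟩⟩ : ↥(Submodule.span ℂ (Set.range (eMid i b))))), 0)) ∧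
        (∀ x : ↥(Submodule.span ℂ (Set.range (eTop i b))),
          x ∈ Submodule.span ℂ (Set.range fun k : ιt i b => (⟨eTop i b k, Submodule.subset_span ⟨k, rfl⟩⟩ : ↥(Submodule.span ℂ (Set.range (eTop i b)))))) ∧
        (∀ y : ↥(Submodule.span ℂ (Set.range (eMid i b))),
          y ∈ Submodule.span ℂ (Set.range fun k : ιm i b => (⟨eMid i b k, Submodule.subset_span ⟨k, rfl⟩⟩ : ↥(Submodule.span ℂ (Set.range (eMid i b)))))) :=
  ⟨fun i b => Classical.choose (exists_threeSlotModel_resGBlock L μ (K' i b) (ω i b) (χ₁ i b) (χ₂ i b) (eTop i b) (eMid i b) (UΛ i b)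
      (hTopSc i b) (hMidSc i b) (horth i b) (hRt i b) (hRm i b) (hC i b)),
    fun i b => Classical.choose_spec (exists_threeSlotModel_resGBlock L μ (K' i b) (ω i b) (χ₁ i b) (χ₂ i b) (eTop i b) (eMid i b) (UΛ i b)
      (hTopSc i b) (hMidSc i b) (horth i b) (hRt i b) (hRm i b) (hC i b))⟩

end Family

end Summit.HodgeConjecture.HodgeConjecture.R90.S8

end
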